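import Mathlib
import HarnessLib

/-!
# Stub `stub_charpolyInv` for the line `Sketch` of the crux `TwoAdicBianchiProModularityLevel`

The characteristic polynomial of the inverse of an invertible `2 × 2` matrix over a field,
expressed through the trace and determinant of the matrix itself:
`charpoly(g⁻¹) = X² − (tr g · (det g)⁻¹) X + (det g)⁻¹`.
For `2 × 2` matrices `g⁻¹ = (det g)⁻¹ • adj g`, `tr (adj g) = tr g`, `det g⁻¹ = (det g)⁻¹`, and the
characteristic polynomial of any `2 × 2` matrix is `X² − C(tr) X + C(det)` (`Matrix.charpoly_fin_two`).
-/

set_option linter.dupNamespace false -- Summit.Langlands.Langlands is the mandated namespace (D-0017)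

open Polynomial
open scoped MatrixGroups

namespace Summit.Langlands.Langlands.Theorems.TwoAdicBianchiProModularityLevel

/-- The trace of the adjugate of a `2 × 2` matrix equals the trace of the matrix. [folklore] -/
private theorem trace_adjugate_fin_two {R : Type*} [CommRing R] (M : Matrix (Fin 2) (Fin 2) R) :
    M.adjugate.trace = M.trace := by
  rw [Matrix.adjugate_fin_two, Matrix.trace_fin_two_of, Matrix.trace_fin_two, add_comm]

/-- The trace of the inverse of a `2 × 2` matrix over a field is `tr M · (det M)⁻¹`. [folklore] -/
private theorem trace_inv_fin_two {F : Type*} [Field F] (M : Matrix (Fin 2) (Fin 2) F) :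
    M⁻¹.trace = M.trace * M.det⁻¹ := by
  rw [Matrix.inv_def, Matrix.trace_smul, Ring.inverse_eq_inv', smul_eq_mul, trace_adjugate_fin_two,
    mul_comm]

/-- The characteristic polynomial of the inverse of an invertible `2 × 2` matrix over a field:
`charpoly(g⁻¹) = X² − (tr g · (det g)⁻¹) X + (det g)⁻¹`. [folklore] -/
theorem stub_charpolyInv : ∀ (F : Type) [Field F] (g : GL (Fin 2) F),
    ((g⁻¹ : GL (Fin 2) F) : Matrix (Fin 2) (Fin 2) F).charpoly =
      X ^ 2 - C ((g : Matrix (Fin 2) (Fin 2) F).trace * ((g : Matrix (Fin 2) (Fin 2) F).det)⁻¹) * X +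
        C ((g : Matrix (Fin 2) (Fin 2) F).det)⁻¹ := by
  intro F _ g
  rw [Matrix.coe_units_inv, Matrix.charpoly_fin_two, trace_inv_fin_two, Matrix.det_nonsing_inv,
    Ring.inverse_eq_inv']

end Summit.Langlands.Langlands.Theorems.TwoAdicBianchiProModularityLevel
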